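import Mathlib
import Literature.Analysis.FluidPDE.Tao2016AveragedNS.BoundedEternalSolutions
import HarnessLib

/-!
# `WakeRatchet.TailRatchet` (stmt-NavierStokesRegularity-21808) — which tables CANNOT carry the
# fronts that would refute it: multiplicatively driven components vanish in every admissible DSS wave

STATUS OF THE ITEM (unchanged by this file, recorded for the census). `TailRatchet` is refuted modulo
the existence of admissible discretely self-similar (DSS) waves on SOME `E₂(R)` table, `R` fixed, at
arbitrarily small scale ratios (`WakeRatchetTailRatchetNegative.tailRatchet_false_of_persistentDSSWaves`,
`WakeRatchetDyadicFront.TailRatchet_false_of_DyadicScalarFronts`); no such wave is constructed in the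
tree or in print at fixed spread (the tree's proved `PerpetualPump.CircuitPump` builds exact DSS
solutions of the SEEDED graded Toda table, but its seed `ε(λ) → 0` as `λ ↓ 1`, i.e. at spread
`2/ε(λ) → ∞`, outside every fixed `InTableClass R`).  The witness table is therefore still to be
found, and this file is NEGATIVE KNOWLEDGE for that search.

THE NO-GO.  In the profile system of a DSS wave (`IsSWave` with damping `1`), suppose some coordinate
`j` of some profile `Φ r` is driven MULTIPLICATIVELY: the `j`-th coordinate of the quadratic part
`Q(Φ_r x) + Λ A(Φ_{π⁻¹r}(x+T)) + Λ⁻¹ B(Φ_{πr}(x−T), Φ_r x)` equals `h(x) · (Φ_r x)_j` with a continuous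
multiplier `h → 0` at the leading edge `x → −∞` (as happens whenever every monomial in row `j` of
the table contains the factor `x_j` and the other profiles tend to `0` ahead of the front — e.g. the
bond row `v̇ = v(a − a₊) − v` of the UNSEEDED graded Toda / Volterra-type tables).  Then
`φ = (Φ_r)_j` solves the scalar linear equation `φ' = (h − 1) φ`, so `|φ(x)| = |φ(x₀)| e^{∫ (1-h)}`
grows like `e^{|x|}` towards `x → −∞` unless `φ ≡ 0`; admissible waves have bounded profiles
(`IsDSSWave.uniformBound`), hence `φ ≡ 0` (`dss_coord_eq_zero_of_multiplicative`).  Consequence for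
the construction item: in any witness table every component that is ever active must receive an
ADDITIVE feed vanishing at rest (the dyadic `x₀²`, the seeded Toda `ε a²`); purely multiplicative
(Lotka–Volterra / unseeded Toda) transfer variables are identically zero in every admissible wave.

Contents: `eq_mul_exp_integral_of_hasDerivAt` (variation of constants for `φ' = g φ`),
`eq_zero_of_hasDerivAt_mul_of_tendsto` (bounded solutions of `φ' = g φ` with `g → c < 0` at `−∞`
vanish), `dss_coord_eq_zero_of_multiplicative` (the table-level no-go).

HONEST FRAMING: MODEL lattice ODEs only (Tao 2016 §4); nothing here concerns the Navier–Stokes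
equations; the item stmt-21808 is neither proved nor refuted by this file.
-/

noncomputable section

set_option linter.dupNamespace false

namespace Summit.NavierStokesRegularity.NavierStokesRegularity.Theorems

namespace WakeRatchetMultiplicativeNoGo

open MeasureTheory Set Filter Topology intervalIntegral
open Literature.Analysis.FluidPDE Literature.Analysis.FluidPDE.TaoCascade

/-! ## The scalar linear equation `φ' = g φ` -/

/-- **Variation of constants.** A solution of `φ' = g φ` on `ℝ` with continuous `g` is
`φ(x) = φ(0) · exp (∫₀ˣ g)`. [folklore] -/
theorem eq_mul_exp_integral_of_hasDerivAt {φ g : ℝ → ℝ} (hg : Continuous g)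
    (hφ : ∀ x, HasDerivAt φ (g x * φ x) x) (x : ℝ) :
    φ x = φ 0 * Real.exp (∫ t in (0 : ℝ)..x, g t) := by
  set G : ℝ → ℝ := fun z => ∫ t in (0 : ℝ)..z, g t with hGdef
  have hG : ∀ y, HasDerivAt G (g y) y := fun y =>
    (hg.integral_hasStrictDerivAt 0 y).hasDerivAt
  -- `ψ = φ · e^{-G}` has zero derivative, hence is constant
  have hψ : ∀ y, HasDerivAt (fun z => φ z * Real.exp (-G z)) 0 y := by
    intro y
    refine ((hφ y).mul ((hG y).neg.exp)).congr_deriv ?_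
    ring
  have hconst := is_const_of_deriv_eq_zero
    (f := fun z => φ z * Real.exp (-G z))
    (fun y => (hψ y).differentiableAt) (fun y => (hψ y).deriv) x 0
  have hG0 : G 0 = 0 := by simp [hGdef]
  simp only [hG0, neg_zero, Real.exp_zero, mul_one] at hconst
  have hexp : Real.exp (-G x) * Real.exp (G x) = 1 := by
    rw [← Real.exp_add, neg_add_cancel, Real.exp_zero]
  calc φ x = φ x * Real.exp (-G x) * Real.exp (G x) := by
        rw [mul_assoc, hexp, mul_one]
    _ = φ 0 * Real.exp (G x) := by rw [hconst]

/-- **Bounded solutions of `φ' = g φ` with `g → c < 0` at `−∞` vanish identically**: otherwise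
`|φ(x)| = |φ(0)| e^{∫₀ˣ g} ≥ |φ(0)| e^{(|c|/2)(X − x) − K} → ∞` as `x → −∞`. [folklore] -/
theorem eq_zero_of_hasDerivAt_mul_of_tendsto {φ g : ℝ → ℝ} {c : ℝ} (hg : Continuous g)
    (hlim : Tendsto g atBot (𝓝 c)) (hc : c < 0)
    (hφ : ∀ x, HasDerivAt φ (g x * φ x) x) (hB : ∃ B : ℝ, ∀ x, |φ x| ≤ B) :
    ∀ x, φ x = 0 := by
  obtain ⟨B, hB⟩ := hB
  suffices h0 : φ 0 = 0 by
    intro x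
    rw [eq_mul_exp_integral_of_hasDerivAt hg hφ x, h0, zero_mul]
  by_contra h0
  have hφ0 : 0 < |φ 0| := abs_pos.2 h0
  -- `g ≤ c/2` on a left half-line `(-∞, X]`, `X ≤ 0`
  have hev : ∀ᶠ t in atBot, g t ≤ c / 2 := hlim.eventually (eventually_le_nhds (by linarith))
  obtain ⟨X₀, hX₀⟩ := eventually_atBot.1 hev
  set X : ℝ := min X₀ 0 with hXdef
  have hXle : ∀ t, t ≤ X → g t ≤ c / 2 := fun t ht => hX₀ t (ht.trans (min_le_left _ _))
  have hX0 : X ≤ 0 := min_le_right _ _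
  set K : ℝ := ∫ t in X..(0 : ℝ), g t with hKdef
  -- the far-left point
  have hB0 : 0 ≤ B := (abs_nonneg _).trans (hB 0)
  set M : ℝ := |K| + B / |φ 0| + 1 with hMdef
  have hM : 0 < M := by
    have h1 : 0 ≤ B / |φ 0| := div_nonneg hB0 hφ0.le
    have h2 : 0 ≤ |K| := abs_nonneg K
    linarith
  set x : ℝ := X - 2 / (-c) * M with hxdef
  have hc' : 0 < -c := neg_pos.2 hc
  have hc0 : c ≠ 0 := hc.ne
  have hxX : x ≤ X := by
    have : 0 ≤ 2 / (-c) * M := by positivity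
    linarith
  -- lower bound for `∫₀ˣ g`
  have hsplit : (∫ t in x..X, g t) + K = ∫ t in x..(0 : ℝ), g t :=
    integral_add_adjacent_intervals (hg.intervalIntegrable _ _) (hg.intervalIntegrable _ _)
  have hmono : ∫ t in x..X, g t ≤ ∫ _t in x..X, c / 2 :=
    integral_mono_on hxX (hg.intervalIntegrable _ _) intervalIntegrable_const
      (fun t ht => hXle t ht.2)
  rw [intervalIntegral.integral_const, smul_eq_mul] at hmono
  have hGx : M - |K| ≤ ∫ t in (0 : ℝ)..x, g t := by
    rw [integral_symm, ← hsplit]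
    have h1 : (X - x) * (c / 2) = -M := by
      rw [hxdef]; field_simp; ring
    have h2 : K ≤ |K| := le_abs_self K
    linarith
  -- the contradiction `B < |φ x|`
  have hφx : |φ x| = |φ 0| * Real.exp (∫ t in (0 : ℝ)..x, g t) := by
    rw [eq_mul_exp_integral_of_hasDerivAt hg hφ x, abs_mul, Real.abs_exp]
  have hge : |φ 0| * (M - |K| + 1) ≤ |φ x| := by
    rw [hφx]
    refine mul_le_mul_of_nonneg_left ?_ hφ0.le
    exact (by linarith : M - |K| + 1 ≤ (∫ t in (0 : ℝ)..x, g t) + 1).trans (Real.add_one_le_exp _)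
  have hval : |φ 0| * (M - |K| + 1) = B + 2 * |φ 0| := by
    rw [hMdef]; field_simp; ring
  linarith [hB x]

/-- The same no-go for the shape `φ' = -φ + h φ` with `h → 0` at `−∞` (damping `1` of the
renormalised lattice plus a vanishing quadratic multiplier). [folklore] -/
theorem eq_zero_of_hasDerivAt_damped_mul {φ h : ℝ → ℝ} (hh : Continuous h)
    (hlim : Tendsto h atBot (𝓝 0))
    (hφ : ∀ x, HasDerivAt φ (-φ x + h x * φ x) x) (hB : ∃ B : ℝ, ∀ x, |φ x| ≤ B) :
    ∀ x, φ x = 0 := by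
  refine eq_zero_of_hasDerivAt_mul_of_tendsto (g := fun x => h x - 1) (c := -1)
    (hh.sub continuous_const) ?_ (by norm_num) (fun x => ?_) hB
  · simpa using hlim.sub_const 1
  · convert hφ x using 1
    ring

/-! ## The table-level no-go for admissible DSS waves -/

/-- **Multiplicatively driven coordinates vanish in every admissible DSS wave.**  Let `Φ` be an
admissible DSS wave of the table `α` (any `m`, any profile family, any `ε₀`).  If for some profile
`r` and coordinate `j` the `j`-th coordinate of the quadratic part of the profile equation is
`h(x) · (Φ r x)_j` with a continuous multiplier `h → 0` as `x → −∞`, then `(Φ r ·)_j ≡ 0`.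
(Profiles are bounded by `IsDSSWave.uniformBound`; then `eq_zero_of_hasDerivAt_damped_mul`.)
[cite: Tao2016AveragedNS, §4 Lemma 4.1 (iii) (4.8) (the profile system); cell theorem] -/
theorem dss_coord_eq_zero_of_multiplicative {ρ : Type*} [Fintype ρ] {m : ℕ} {ε₀ : ℝ}
    {α : Fin m → Fin m → Fin m → ℤ × ℤ × ℤ → ℝ} {π : Equiv.Perm ρ} {T : ℝ} {Φ : ρ → ℝ → Em m}
    (hW : IsDSSWave ε₀ α π T Φ) (r : ρ) (j : Fin m) {h : ℝ → ℝ} (hh : Continuous h)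
    (hlim : Tendsto h atBot (𝓝 0))
    (hmul : ∀ x, (tableQ α (Φ r x) + bigLam ε₀ • tableA α (Φ (π.symm r) (x + T))
        + (bigLam ε₀)⁻¹ • tableB α (Φ (π r) (x - T)) (Φ r x)) j = h x * (Φ r x) j) :
    ∀ x, Φ r x j = 0 := by
  -- the coordinate law `φ' = -φ + h φ`
  have hφ : ∀ x, HasDerivAt (fun y => Φ r y j) (-(Φ r x j) + h x * Φ r x j) x := by
    intro x
    have hw := hW.wave r x
    have hc := ((EuclideanSpace.proj j : Em m →L[ℝ] ℝ).hasFDerivAt).comp_hasDerivAt x hw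
    have heq : ((EuclideanSpace.proj j : Em m →L[ℝ] ℝ) : Em m → ℝ) ∘ Φ r = fun y => Φ r y j := by
      funext y
      simp [EuclideanSpace.coe_proj]
    rw [heq] at hc
    have hv : -((1 : ℝ) • Φ r x) + tableQ α (Φ r x) + bigLam ε₀ • tableA α (Φ (π.symm r) (x + T))
          + (bigLam ε₀)⁻¹ • tableB α (Φ (π r) (x - T)) (Φ r x)
        = -((1 : ℝ) • Φ r x) + (tableQ α (Φ r x) + bigLam ε₀ • tableA α (Φ (π.symm r) (x + T))
          + (bigLam ε₀)⁻¹ • tableB α (Φ (π r) (x - T)) (Φ r x)) := by abel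
    rw [hv] at hc
    refine hc.congr_deriv ?_
    rw [EuclideanSpace.coe_proj]
    beta_reduce
    rw [PiLp.add_apply, PiLp.neg_apply, PiLp.smul_apply, hmul x, smul_eq_mul, one_mul]
  -- bounded coordinate
  have hB : ∃ B : ℝ, ∀ x, |Φ r x j| ≤ B := by
    obtain ⟨C, hC⟩ := hW.uniformBound
    refine ⟨C, fun x => ?_⟩
    have h1 : ‖(Φ r x) j‖ ≤ ‖Φ r x‖ := PiLp.norm_apply_le (Φ r x) j
    rw [Real.norm_eq_abs] at h1
    exact h1.trans (hC r x)
  exact eq_zero_of_hasDerivAt_damped_mul hh hlim hφ hB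

end WakeRatchetMultiplicativeNoGo

end Summit.NavierStokesRegularity.NavierStokesRegularity.Theorems

end
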